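import Literature.Geometry.Manifold.CompactSupportFlow
import Mathlib.Geometry.Manifold.ContMDiff.NormedSpace
import Mathlib.Geometry.Manifold.VectorBundle.Tangent
import Mathlib.Analysis.Calculus.MeanValue
import HarnessLib

/-!
# The global flow of a compactly supported vector field on a vector space, in calculus terms

General differential topology (topic `Geometry/Manifold`), the vector-space form of
`CompactSupportFlow.lean` (Lee, *Introduction to Smooth Manifolds*, 2nd ed. (2012), Thm. 9.16:
compactly supported fields are complete; Thm. 9.12: the flow is smooth), written as the input
layer of the Dehn-twist package of the Dehn–Nielsen–Baer seat (`FlowPeriodFunction.lean`,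
`FlowPeriodicFamily.lean`: there the flow is a map `θ : ℝ × E → E` with `ContDiff ℝ ∞ θ`, the
first integrals are functions `H` with `H (θ (t, x)) = H x`, and velocities are `HasDerivAt`
statements).  For a real Banach space `E` and a smooth vector field `V : E → E` vanishing off a
compact set:

* `exists_contDiff_globalFlow` — **`V` has a smooth global flow** `θ : ℝ × E → E`:
  `ContDiff ℝ ∞ θ`, `θ(0, x) = x`, `θ(t, θ(s, x)) = θ(t + s, x)`, `∂ₜθ(t, x) = V(θ(t, x))`
  (`HasDerivAt`), and `θ(t, x) = x` at the zeros of `V`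
  (from `exists_contMDiff_globalFlow_of_eq_zero_off_isCompact` on the manifold `E`; that `V` is a
  smooth section of the (trivial) tangent bundle of the model space `E` is Mathlib's
  `contMDiff_vectorSpace_iff_contDiff`);
* `apply_flow_eq_of_fderiv_comp_eq_zero` — **a function annihilated by `V` is a first integral**:
  `dG(V) = 0 ⇒ G(θ(t, x)) = G x` (`is_const_of_deriv_eq_zero`);
* `apply_flow_ne_self_zero`/`vectorField_flow_ne_zero` — the field does not vanish along the orbit
  of a point where it does not vanish (zeros are fixed points; group law);
* `exists_velocity_ne_zero` — the velocity hypothesis of `exists_period_package` /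
  `exists_twistDiffeomorph` along the orbits through a set on which `V ≠ 0`.

Everything is proved; no definitions, no named facts (D-0026).

## References

* J. M. Lee, *Introduction to Smooth Manifolds*, 2nd ed., GTM 218 (2012), Thm. 9.12, Thm. 9.16.
  [LeeSmoothManifolds2013]
-/

open scoped Manifold ContDiff Topology
open Set Function Bundle

noncomputable section

namespace Literature.Geometry.Manifold

universe u

section VectorSpace

variable {E : Type u} [NormedAddCommGroup E] [NormedSpace ℝ E] [CompleteSpace E]

/-- **The smooth global flow of a compactly supported smooth vector field on a Banach space**, in
calculus terms (Lee (2012), Thm. 9.16 with Thm. 9.12). [cite: LeeSmoothManifolds2013, Thm. 9.16 and Thm. 9.12] -/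
theorem exists_contDiff_globalFlow {V : E → E} (hV : ContDiff ℝ ∞ V) {K : Set E} (hK : IsCompact K)
    (hVK : ∀ x, x ∉ K → V x = 0) :
    ∃ θ : ℝ × E → E, ContDiff ℝ ∞ θ ∧ (∀ x, θ (0, x) = x) ∧
      (∀ t s x, θ (t, θ (s, x)) = θ (t + s, x)) ∧
      (∀ x t, HasDerivAt (fun t => θ (t, x)) (V (θ (t, x))) t) ∧
      ∀ x, V x = 0 → ∀ t, θ (t, x) = x := by
  obtain ⟨θ, hθ, h0, hadd, hint, hfix⟩ :=
    -- the field as a smooth section of the (trivial) tangent bundle of the model space `E`: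
    -- Mathlib's `contMDiff_vectorSpace_iff_contDiff` (dedup-02108)
    exists_contMDiff_globalFlow_of_eq_zero_off_isCompact (I := 𝓘(ℝ, E)) (M := E) (n := (⊤ : ℕ∞))
      (contMDiff_vectorSpace_iff_contDiff.mpr hV) (by simp) hK hVK
  refine ⟨θ, ?_, h0, hadd, fun x t => ?_, hfix⟩
  · have h2 : ContMDiff 𝓘(ℝ, ℝ × E) 𝓘(ℝ, E) ∞ θ := by
      rw [modelWithCornersSelf_prod, ← chartedSpaceSelf_prod]; exact hθ
    exact contMDiff_iff_contDiff.1 h2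
  · have h := ((hint x).isMIntegralCurveAt t).eventually_hasDerivAt.self_of_nhds
    rw [tangentCoordChange_self (I := 𝓘(ℝ, E)) (by simp)] at h
    simp only [extChartAt_model_space_eq_id] at h
    simpa using h

end VectorSpace

section Algebra

variable {E : Type u} [NormedAddCommGroup E] [NormedSpace ℝ E]

/-- **A function annihilated by the field is a first integral of the flow**: if `dG(V) = 0`
everywhere then `G(θ(t, x)) = G x` along every curve with velocity `V`. [folklore] -/
theorem apply_flow_eq_of_fderiv_comp_eq_zero {F' : Type*} [NormedAddCommGroup F'] [NormedSpace ℝ F']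
    {θ : ℝ × E → E} {V : E → E} (h0 : ∀ x, θ (0, x) = x)
    (hint : ∀ x t, HasDerivAt (fun t => θ (t, x)) (V (θ (t, x))) t)
    {G : E → F'} (hG : Differentiable ℝ G) (hGV : ∀ x, fderiv ℝ G x (V x) = 0) (t : ℝ) (x : E) :
    G (θ (t, x)) = G x := by
  have hd : ∀ s, HasDerivAt (fun s => G (θ (s, x))) (0 : F') s := fun s => by
    have h := (hG (θ (s, x))).hasFDerivAt.comp_hasDerivAt s (hint x s)
    rw [hGV] at h
    exact h
  have hconst := is_const_of_deriv_eq_zero (f := fun s => G (θ (s, x)))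
    (fun s => (hd s).differentiableAt) (fun s => (hd s).deriv) t 0
  simpa [h0] using hconst

omit [NormedSpace ℝ E] in
/-- **The field does not vanish along the orbit of a point where it does not vanish** (zeros of the
field are fixed points of the flow; group law). [folklore] -/
theorem vectorField_flow_ne_zero {θ : ℝ × E → E} {V : E → E} (h0 : ∀ x, θ (0, x) = x)
    (hadd : ∀ t s x, θ (t, θ (s, x)) = θ (t + s, x)) (hfix : ∀ x, V x = 0 → ∀ t, θ (t, x) = x)
    {x : E} (hx : V x ≠ 0) (t : ℝ) : V (θ (t, x)) ≠ 0 := by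
  intro hzero
  have hback : θ (-t, θ (t, x)) = θ (t, x) := hfix _ hzero (-t)
  rw [hadd, neg_add_cancel, h0] at hback
  exact hx (hback ▸ hzero)

/-- **The velocity hypothesis of the twist package**: along the orbits through the points `σ s`,
`s ∈ J`, of a set on which the field does not vanish, the velocity never vanishes.
[folklore] -/
theorem exists_velocity_ne_zero {F : Type*} {θ : ℝ × E → E} {V : E → E} (h0 : ∀ x, θ (0, x) = x)
    (hadd : ∀ t s x, θ (t, θ (s, x)) = θ (t + s, x)) (hfix : ∀ x, V x = 0 → ∀ t, θ (t, x) = x)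
    (hint : ∀ x t, HasDerivAt (fun t => θ (t, x)) (V (θ (t, x))) t)
    {σ : F → E} {J : Set F} (hσ : ∀ s ∈ J, V (σ s) ≠ 0) :
    ∀ u : ℝ, ∀ s ∈ J, ∃ v : E, v ≠ 0 ∧ HasDerivAt (fun t => θ (t, σ s)) v u :=
  fun u s hs => ⟨V (θ (u, σ s)), vectorField_flow_ne_zero h0 hadd hfix (hσ s hs) u, hint (σ s) u⟩

omit [NormedSpace ℝ E] in
/-- **The flow maps `{V ≠ 0}` to itself** (a point at which `V = 0` does not move, so the
complement of the zero set is invariant). [folklore] -/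
theorem flow_mem_setOf_ne_zero {θ : ℝ × E → E} {V : E → E} (h0 : ∀ x, θ (0, x) = x)
    (hadd : ∀ t s x, θ (t, θ (s, x)) = θ (t + s, x)) (hfix : ∀ x, V x = 0 → ∀ t, θ (t, x) = x)
    {x : E} (hx : x ∈ {y | V y ≠ 0}) (t : ℝ) : θ (t, x) ∈ {y | V y ≠ 0} :=
  vectorField_flow_ne_zero h0 hadd hfix hx t

end Algebra

end Literature.Geometry.Manifold

end
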